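import Literature.Geometry.Symplectic.CompatibleMetricUnitaryFrameField
import Literature.Geometry.Symplectic.CompatibleMetricOrientation
import Literature.Geometry.GaugeTheory.AdaptedFramesSpincStructure
import Literature.Geometry.GaugeTheory.SeibergWittenEquations
import HarnessLib

/-!
# The canonical `Spin^c` structure of a symplectic (almost Kähler) `4`-manifold

Topic `Literature/Geometry/Symplectic`; assembles `CompatibleMetric.lean` (the metric `g_J`),
`CompatibleMetricUnitaryFrameField.lean` (smooth local unitary frames),
`CompatibleMetricOrientation.lean` (unitary frames are positive for the symplectic orientation) and
`Literature/Geometry/GaugeTheory/AdaptedFramesSpincStructure.lean` (adapted frames define a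
`Spin^c` structure through `ρ : U(2) → Spin^c(4)`).

C. H. Taubes, *The Seiberg–Witten invariants and symplectic forms*, Math. Res. Lett. 1 (1994)
809–822, and *The Seiberg–Witten and Gromov invariants*, Math. Res. Lett. 2 (1995) 221–238, §5
Step 1: "Use a metric on `X` where the symplectic form `ω` is self-dual with norm `√2` … the
canonical `Spin^c` structure (the one with `c₁(L) = -K`, whose `S⁺ = I ⊕ K⁻¹`)". J. W. Morgan,
*The Seiberg–Witten Equations …* (1996), Cor. 3.4.5: an almost complex structure compatible with
the metric determines a `Spin^c` structure whose determinant line bundle is `K_X⁻¹`.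

This file DEFINES, for a `C^∞` `4`-manifold `N` (charted on `ℝ⁴`) with a smooth nondegenerate
`2`-form `s` and an `s`-compatible almost complex structure `J` (0 new facts):

* `unitaryNbhd h hs x₀`, `unitaryFrameAt h hs x₀` — a choice of smooth local unitary frame near
  each point (`exists_smooth_unitaryFrame`);
* `unitaryAdaptedFrames h hs hnd : AdaptedFrames g_J o_s J N` — the unitary reduction of the
  frame bundle of `(N, g_J, o_s)` (`o_s` the symplectic smooth orientation), indexed by the points
  of `N`;
* **`canonicalSpincStructure h hs hnd : SpincStructure g_J o_s N`** — the canonical `Spin^c`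
  structure of `(N, s, J)` in the Čech form of the tree's gauge theory, so that the Seiberg–Witten
  equations, moduli spaces and `swInvariantModTwo` of `Literature/Geometry/GaugeTheory` apply to it;
  its determinant cocycle is the complex determinant of the unitary frame changes, i.e. the
  transition functions of `det T_ℂ N = K⁻¹` (`detLineBundle_canonicalSpincStructure`).  It is a
  REPRESENTATIVE: the local unitary frames are chosen (`Classical.choose`); another choice changes
  the Čech data by a unitary change of frames in each `U_i`, i.e. gives an isomorphic `Spin^c`
  structure (Morgan 1996, Cor. 3.4.5: the structure is determined by `(g, J)`), a relation the
  tree's `SpincStructure` (raw Čech data) does not quotient by;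
* in every frame of the structure `s = e⁰¹ + e²³` is self-dual and acts on `S⁺` by `diag(2i, −2i)`
  (`I = Λ⁰` the `−2i`-eigenspace, Taubes 1995 (2.2)), and the real multiples `r · s` are
  perturbations for it (`symplecticPerturbation`, Taubes's deformation (1.7)/(4.4)).

## References

* C. H. Taubes, *The Seiberg–Witten and Gromov invariants*, Math. Res. Lett. 2 (1995) 221–238,
  §5 Step 1. [Taubes1995]
* J. W. Morgan, *The Seiberg–Witten Equations and Applications to the Topology of Smooth
  Four-Manifolds*, Princeton Math. Notes 44 (1996), Cor. 3.4.5. [MorganSWBook1996]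
-/

noncomputable section

open scoped Manifold ContDiff EuclideanSpace
open Module Bundle Literature.Geometry.Kaehler Literature.Geometry.GaugeTheory Literature.Topology.FourManifolds
open Literature.Geometry.Lorentzian (PseudoRiemannianMetric)

namespace Literature.Geometry.Symplectic

namespace AlmostComplexStructure.IsCompatibleWith

variable {N : Type*} [TopologicalSpace N] [ChartedSpace (EuclideanSpace ℝ (Fin 4)) N]
  [IsManifold (𝓡 4) ∞ N] {J : AlmostComplexStructure (𝓡 4) ∞ N} {s : MForm (𝓡 4) N ℝ 2}
  (h : J.IsCompatibleWith s) (hs : IsSmoothForm s)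
  (hnd : ∀ x (v : TangentSpace (𝓡 4) x), v ≠ 0 → ∃ w : TangentSpace (𝓡 4) x, s x ![v, w] ≠ 0)

/-! ### A smooth local unitary frame near each point -/

/-- **A neighbourhood of `x₀` carrying a smooth unitary frame** (a choice, from
`exists_smooth_unitaryFrame`). [cite: MorganSWBook1996, Cor. 3.4.5] -/
def unitaryNbhd (x₀ : N) : Set N :=
  (h.exists_smooth_unitaryFrame hs x₀).choose

/-- **The chosen smooth unitary frame near `x₀`.** [cite: MorganSWBook1996, Cor. 3.4.5] -/
def unitaryFrameAt (x₀ : N) : Fin 4 → Π x : N, TangentSpace (𝓡 4) x :=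
  (h.exists_smooth_unitaryFrame hs x₀).choose_spec.2.2.choose

/-- The chosen neighbourhood is open. [folklore] -/
theorem isOpen_unitaryNbhd (x₀ : N) : IsOpen (h.unitaryNbhd hs x₀) :=
  (h.exists_smooth_unitaryFrame hs x₀).choose_spec.1

/-- The chosen neighbourhood contains its centre. [folklore] -/
theorem mem_unitaryNbhd (x₀ : N) : x₀ ∈ h.unitaryNbhd hs x₀ :=
  (h.exists_smooth_unitaryFrame hs x₀).choose_spec.2.1

/-- The chosen frame is a `g_J`-orthonormal `J`-adapted frame on the neighbourhood.
[cite: MorganSWBook1996, Cor. 3.4.5] -/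
theorem unitaryFrameAt_spec (x₀ : N) {x : N} (hx : x ∈ h.unitaryNbhd hs x₀) :
    (h.metric hs).IsOrthonormalFrame x (fun i ↦ h.unitaryFrameAt hs x₀ i x) ∧
      h.unitaryFrameAt hs x₀ 1 x = J x (h.unitaryFrameAt hs x₀ 0 x) ∧
      h.unitaryFrameAt hs x₀ 3 x = J x (h.unitaryFrameAt hs x₀ 2 x) :=
  (h.exists_smooth_unitaryFrame hs x₀).choose_spec.2.2.choose_spec.1 x hx

/-- The chosen frame is smooth on the neighbourhood. [cite: MorganSWBook1996, Cor. 3.4.5] -/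
theorem contMDiffAt_unitaryFrameAt (x₀ : N) (i : Fin 4) {x : N} (hx : x ∈ h.unitaryNbhd hs x₀) :
    ContMDiffAt (𝓡 4) ((𝓡 4).prod 𝓘(ℝ, EuclideanSpace ℝ (Fin 4))) ∞
      (fun y ↦ TotalSpace.mk' (EuclideanSpace ℝ (Fin 4)) y (h.unitaryFrameAt hs x₀ i y)) x :=
  (h.exists_smooth_unitaryFrame hs x₀).choose_spec.2.2.choose_spec.2 i x hx

/-! ### The unitary reduction and the canonical `Spin^c` structure -/

/-- **The unitary reduction of the frame bundle of `(N, g_J, o_s)`** by the chosen local unitary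
frames, indexed by the points of `N` (Morgan 1996, Cor. 3.4.5; the frames are positive for the
symplectic orientation, `isPosOrthonormalFrame_of_unitary`). [cite: MorganSWBook1996, Cor. 3.4.5] -/
def unitaryAdaptedFrames :
    AdaptedFrames (h.metric hs) (symplecticSmoothOrientation s hs hnd)
      (fun x ↦ ((J x : TangentSpace (𝓡 4) x →L[ℝ] TangentSpace (𝓡 4) x) :
        TangentSpace (𝓡 4) x →ₗ[ℝ] TangentSpace (𝓡 4) x)) N where
  baseSet := h.unitaryNbhd hs
  isOpen_baseSet := h.isOpen_unitaryNbhd hs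
  exists_mem_baseSet x := ⟨x, h.mem_unitaryNbhd hs x⟩
  frame := h.unitaryFrameAt hs
  isPosOrthonormalFrame_frame x₀ x hx :=
    h.isPosOrthonormalFrame_of_unitary hs hnd x (h.unitaryFrameAt_spec hs x₀ hx).1
      (h.unitaryFrameAt_spec hs x₀ hx).2.1 (h.unitaryFrameAt_spec hs x₀ hx).2.2
  contMDiffOn_frame x₀ k x hx := (h.contMDiffAt_unitaryFrameAt hs x₀ k hx).contMDiffWithinAt
  isAdaptedFrame_frame x₀ x hx := by
    obtain ⟨-, h1, h3⟩ := h.unitaryFrameAt_spec hs x₀ hx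
    refine ⟨?_, ?_, ?_, ?_⟩ <;> simp only [ContinuousLinearMap.coe_coe]
    · exact h1.symm
    · rw [h1, J.map_map]
    · exact h3.symm
    · rw [h3, J.map_map]

/-- **The canonical `Spin^c` structure of the symplectic `4`-manifold `(N, s)` with compatible `J`**
(Taubes 1995, §5 Step 1: "the canonical `Spin^c` structure", `S⁺ = I ⊕ K⁻¹`; Morgan 1996,
Cor. 3.4.5), as a `SpincStructure` over `(N, g_J, o_s)` in the tree's Čech form. [cite: Taubes1995, §5 Step 1] -/
def canonicalSpincStructure : SpincStructure (h.metric hs) (symplecticSmoothOrientation s hs hnd) N :=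
  (h.unitaryAdaptedFrames hs hnd).toSpincStructure

/-- The frames of the canonical `Spin^c` structure are the chosen unitary frames (definitional).
[cite: MorganSWBook1996, Cor. 3.4.5] -/
@[simp] theorem canonicalSpincStructure_frame :
    (h.canonicalSpincStructure hs hnd).frame = h.unitaryFrameAt hs := rfl

/-- The cover of the canonical `Spin^c` structure (definitional). [cite: MorganSWBook1996, Cor. 3.4.5] -/
@[simp] theorem canonicalSpincStructure_baseSet :
    (h.canonicalSpincStructure hs hnd).baseSet = h.unitaryNbhd hs := rfl

/-- **The frames of the canonical `Spin^c` structure are unitary**: `e₁ = Je₀`, `e₃ = Je₂` on each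
set of the cover. [cite: MorganSWBook1996, Cor. 3.4.5] -/
theorem canonicalSpincStructure_frame_unitary (x₀ : N) {x : N} (hx : x ∈ (h.canonicalSpincStructure hs hnd).baseSet x₀) :
    (h.canonicalSpincStructure hs hnd).frame x₀ 1 x = J x ((h.canonicalSpincStructure hs hnd).frame x₀ 0 x) ∧
      (h.canonicalSpincStructure hs hnd).frame x₀ 3 x = J x ((h.canonicalSpincStructure hs hnd).frame x₀ 2 x) :=
  (h.unitaryFrameAt_spec hs x₀ hx).2

/-- **The determinant line bundle of the canonical `Spin^c` structure is `K⁻¹ = det T_ℂ N`**: its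
cocycle is the complex determinant of the unitary frame changes `h_ij ∈ U(2)` (Morgan 1996,
Cor. 3.4.5; Taubes 1995, §1 (c): "`c₁(L) = -K`" for the canonical structure). [cite: MorganSWBook1996, Cor. 3.4.5] -/
theorem detLineBundle_canonicalSpincStructure (x₀ x₁ : N) (x : N) :
    (h.canonicalSpincStructure hs hnd).detLineBundle.toFun x₀ x₁ x =
      ((h.unitaryAdaptedFrames hs hnd).changeMatrix x₀ x₁ x).det :=
  (h.unitaryAdaptedFrames hs hnd).detLineBundle_toSpincStructure_toFun x₀ x₁ x

/-- **`J` reads as `i·` in every frame of the canonical `Spin^c` structure** (so that its spinor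
bundle splits as `S⁺ = Λ⁰ ⊕ Λ^{0,2}`, Morgan 1996, Cor. 3.4.6, at the level of the structure group).
[cite: MorganSWBook1996, §3.4] -/
theorem frameCoord_canonicalSpincStructure_map (x₀ : N) {x : N}
    (hx : x ∈ (h.canonicalSpincStructure hs hnd).baseSet x₀) (v : TangentSpace (𝓡 4) x) :
    frameCoord (h.metric hs) x (fun k ↦ (h.canonicalSpincStructure hs hnd).frame x₀ k x) (J x v) =
      modelJ (frameCoord (h.metric hs) x (fun k ↦ (h.canonicalSpincStructure hs hnd).frame x₀ k x) v) :=
  (h.unitaryAdaptedFrames hs hnd).frameCoord_map x₀ hx v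

/-! ### The symplectic form and the canonical `Spin^c` structure -/

/-- **`s` is self-dual in every frame of the canonical `Spin^c` structure** (Taubes 1995, §5 Step 1:
"a metric on `X` where the symplectic form `ω` is self-dual"). [cite: Taubes1995, §5 Step 1 (p. 233)] -/
theorem isSelfDualTwo_twoFormMatrix_canonicalSpincStructure (x₀ : N) {x : N}
    (hx : x ∈ (h.canonicalSpincStructure hs hnd).baseSet x₀) :
    IsSelfDualTwo (twoFormMatrix s x fun k ↦ (h.canonicalSpincStructure hs hnd).frame x₀ k x) :=
  h.isSelfDualTwo_twoForm_unitaryFrame hs x (h.unitaryFrameAt_spec hs x₀ hx).1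
    (h.unitaryFrameAt_spec hs x₀ hx).2.1 (h.unitaryFrameAt_spec hs x₀ hx).2.2

/-- **The coefficient matrix of `s` in every frame of the canonical `Spin^c` structure is
`e⁰¹ + e²³`** (so `|s| = √2`). [cite: Taubes1995, §5 Step 1 (p. 233)] -/
theorem twoFormMatrix_canonicalSpincStructure (x₀ : N) {x : N}
    (hx : x ∈ (h.canonicalSpincStructure hs hnd).baseSet x₀) :
    twoFormMatrix s x (fun k ↦ (h.canonicalSpincStructure hs hnd).frame x₀ k x) =
      !![0, 1, 0, 0; -1, 0, 0, 0; 0, 0, 0, 1; 0, 0, -1, 0] :=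
  h.twoForm_unitaryFrame_eq hs x (h.unitaryFrameAt_spec hs x₀ hx).1
    (h.unitaryFrameAt_spec hs x₀ hx).2.1 (h.unitaryFrameAt_spec hs x₀ hx).2.2

/-- **Clifford multiplication by `s` on `S⁺` is `diag(2i, −2i)` in every frame of the canonical
`Spin^c` structure**: it preserves the splitting `S⁺ = Λ² ⊕ Λ⁰ = K⁻¹ ⊕ I`, the trivial summand
`I` being the `−2i`-eigenspace (Taubes 1995, §2, remark after (2.2); Taubes 1994, §1: "The form `ω`
defines the splitting; the summand `I` is an eigenspace for Clifford multiplication by `ω`").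
[cite: Taubes1995, §2 (2.2) (p. 226)] -/
theorem plusAction_twoFormMatrix_canonicalSpincStructure (x₀ : N) {x : N}
    (hx : x ∈ (h.canonicalSpincStructure hs hnd).baseSet x₀) :
    plusAction (twoFormMatrix s x fun k ↦ (h.canonicalSpincStructure hs hnd).frame x₀ k x) =
      !![2 * Complex.I, 0; 0, -(2 * Complex.I)] :=
  h.plusAction_twoForm_unitaryFrame hs x (h.unitaryFrameAt_spec hs x₀ hx).1
    (h.unitaryFrameAt_spec hs x₀ hx).2.1 (h.unitaryFrameAt_spec hs x₀ hx).2.2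

/-- **Taubes's perturbations**: every real multiple `r · s` of the symplectic form is a perturbation
(smooth `g_J`-self-dual `2`-form) for the canonical `Spin^c` structure — the family entering the
deformed curvature equation `F_A⁺ = q(ψ) − (ir/4)·ω + …` of Taubes 1994, (2) / Taubes 1995, (1.7)
with (4.4). [cite: Taubes1995, §1 (1.7) and §4 (4.4)] -/
def symplecticPerturbation (r : ℝ) : (h.canonicalSpincStructure hs hnd).Perturbation where
  form := r • s
  isSmoothForm := hs.smul r
  isSelfDual x₀ x hx := by
    have hmat : twoFormMatrix (r • s) x (fun k ↦ (h.canonicalSpincStructure hs hnd).frame x₀ k x) =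
        r • twoFormMatrix s x (fun k ↦ (h.canonicalSpincStructure hs hnd).frame x₀ k x) := by
      ext a b; rfl
    unfold IsSelfDualTwo
    rw [hmat, hodgeStarTwo_smul, (h.isSelfDualTwo_twoFormMatrix_canonicalSpincStructure hs hnd x₀ hx)]

/-- The form of Taubes's perturbation is `r · s` (definitional). [cite: Taubes1995, §1 (1.7)] -/
@[simp] theorem symplecticPerturbation_form (r : ℝ) :
    (h.symplecticPerturbation hs hnd r).form = r • s := rfl

end AlmostComplexStructure.IsCompatibleWith

end Literature.Geometry.Symplectic

end
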